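import Summits.SmoothPoincare4.SmoothPoincare4.Theorems.CylinderEntropyImmortalAreaToFloorCoareaShadow
import Summits.SmoothPoincare4.SmoothPoincare4.Theorems.CylinderEntropyImmortalAreaToFloorTelescopingLevels
import Summits.SmoothPoincare4.SmoothPoincare4.Theorems.CylinderEntropyCylinderRungTwoFluxIdentitySides
import HarnessLib

/-!
# Route `CylinderEntropy`, item `ImmortalAreaToFloor` (stmt-SmoothPoincare4-17197):
# the WINDOW CERTIFICATE — profile disagreement of two column populations costs L¹-tilt

Assembly of the bricks (TEL, levels) `CubeTelescoping.mul_volume_mul_volume_le_lintegral_levels` (p134822) and (CO')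
`lintegral_volume_slice_image_coords_le` (p135615) of the Allard-free blueprint for the residual `ThinSeq` of the item
(evidence `ANALYSIS-prover-17197-c1.md`, §§6, 8, 10).  Setting: a closed embedded cross-section `ι : M → N = S⁴ × ℝ` with
continuous unit normal `ν` tangent to `N`; an open "material region" `U ⊆ ℝ⁶` whose frontier points on `N` lie on `Σ = ι(M)`;
an orthonormal frame `(b₀, …, b₃)` of `q₀^⊥` at a pole `q₀ ∈ S⁴`, giving the projection chart `u ↦ Φ u = Σ uₖ bₖ + √(1-|u|²) q₀`
of the hemisphere with coordinates `uₖ = ⟪bₖ, ·⟫`; a chart box `Q = Icc lo hi` inside the open unit disc; a height window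
`(w₁, w₂)`; and two measurable column populations `A, F ⊆ Q` such that every pair `(x, y) ∈ A × F` DISAGREES (material versus
air: `(Φ x, c) ∈ U ↔ (Φ y, c) ∉ U`) on a set of levels `c ∈ (w₁, w₂)` of measure `≥ d`.  Then

* **`mul_volume_mul_volume_le_lintegral_tilt`** —
  `d · vol(A) · vol(F) ≤ 2 vol(Q) (Σⱼ (hiⱼ - loⱼ)) · ∫⁻_{Σ ∩ (Q-columns × [w₁, w₂])} 2‖ν'‖ d(ι^* μHE⁴)`.

So the certificate currency is the L¹-TILT of the column box, which is additive over disjoint boxes and globally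
`≤ 2 √(area · ∫(1 - ν₅²))`.  Proof: telescoping over levels for the open set `U' = {(u, c) : |u| < 1, c ∈ (w₁, w₂),
(Φ u, c) ∈ U}` of chart space; a frontier point of a chart slice at level `c` inside `Q` is a point of `Σ` of height `c` whose
chart coordinates lie in `Q` (frontier hypothesis), so its `j`-deleted shadow lies in the `c`-slice of the image of
`S = ι⁻¹(Q-columns × [w₁, w₂])` under `(height, ⟪b_{j.succAbove m}, ·⟫ₘ)`; these are the coordinates with respect to four
vectors of the orthonormal basis `(padL b_{j.succAbove ·}, e₅ ; padL bⱼ, padL q₀)` of `ℝ⁶`, whose deleted vectors are horizontal,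
and (CO') bounds the level-integrated slice volumes by the tilt integral.  Everything is proved; no definition, no named fact.
-/

-- the prescribed namespace `Summit.SmoothPoincare4.SmoothPoincare4.…` repeats `SmoothPoincare4`
set_option linter.dupNamespace false

noncomputable section

open MeasureTheory Set Function Filter Module
open scoped Manifold ContDiff ENNReal Topology RealInnerProductSpace NNReal BigOperators

namespace Summit.SmoothPoincare4.SmoothPoincare4.Theorems.CylinderRungTwo.KillingFlux

open Literature.Geometry.Riemannian
open Literature.Geometry.Lorentzian Literature.Geometry.Lorentzian.PseudoRiemannianMetric
open Literature.Geometry.Riemannian.SphericalCylinderEntropy (truncL truncL_apply)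
open Literature.Geometry.Manifold.CylinderSlice (axis padL padL_apply_castSucc padL_apply_last castSucc_ne_five)
open Summit.SmoothPoincare4.SmoothPoincare4.Theorems.CubeTelescoping

/-! ### The orthonormal basis of `ℝ⁶` attached to a frame of `q₀^⊥` and a deleted direction -/

/-- `⟪padL y, z⟫ = ⟪y, truncL z⟫`. [folklore] -/
theorem inner_padL_left (y : EuclideanSpace ℝ (Fin 5)) (z : EuclideanSpace ℝ (Fin 6)) :
    ⟪padL y, z⟫ = ⟪y, truncL z⟫ := by
  rw [inner_eq_sum_castSucc, padL_apply_last, zero_mul, add_zero, PiLp.inner_apply]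
  refine Finset.sum_congr rfl fun i _ => ?_
  simp [padL_apply_castSucc, truncL_apply, mul_comm]

/-- `⟪padL y, padL y'⟫ = ⟪y, y'⟫`. [folklore] -/
theorem inner_padL_padL (y y' : EuclideanSpace ℝ (Fin 5)) : ⟪padL y, padL y'⟫ = ⟪y, y'⟫ := by
  rw [inner_padL_left]
  congr 1
  ext i
  rw [truncL_apply, padL_apply_castSucc]

/-- `⟪padL y, e₅⟫ = 0`. [folklore] -/
theorem inner_padL_axis (y : EuclideanSpace ℝ (Fin 5)) :
    ⟪padL y, (axis : EuclideanSpace ℝ (Fin 6))⟫ = 0 := by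
  rw [real_inner_comm, inner_axis_left, padL_apply_last]

/-- `⟪e₅, e₅⟫ = 1`. [folklore] -/
theorem inner_axis_axis : ⟪(axis : EuclideanSpace ℝ (Fin 6)), (axis : EuclideanSpace ℝ (Fin 6))⟫ = 1 := by
  rw [inner_axis_left]
  simp [axis]

/-- **The orthonormal basis of a frame with one deleted direction.** For an orthonormal frame `b₀, …, b₃` of `q₀^⊥`
(`‖q₀‖ = 1`) and `j : Fin 4` there is an orthonormal basis `B` of `ℝ⁶` indexed by `Fin 4 ⊕ Fin 2` with kept vectors
`B (inl m) = padL b_{j.succAbove m}` (`m < 3`), `B (inl 3) = e₅` and deleted (horizontal) vectors `B (inr 0) = padL bⱼ`,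
`B (inr 1) = padL q₀`. [folklore] -/
theorem exists_orthonormalBasis_of_frame {q₀ : EuclideanSpace ℝ (Fin 5)} {b : Fin 4 → EuclideanSpace ℝ (Fin 5)}
    (hb : Orthonormal ℝ b) (hq₀ : ‖q₀‖ = 1) (hbq : ∀ k, ⟪b k, q₀⟫ = 0) (j : Fin 4) :
    ∃ B : OrthonormalBasis (Fin 4 ⊕ Fin 2) ℝ (EuclideanSpace ℝ (Fin 6)),
      (∀ m : Fin 3, B (Sum.inl (Fin.castSucc m)) = padL (b (j.succAbove m))) ∧
      B (Sum.inl (Fin.last 3)) = axis ∧ B (Sum.inr 0) = padL (b j) ∧ B (Sum.inr 1) = padL q₀ := by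
  classical
  set d : Fin 2 → EuclideanSpace ℝ (Fin 5) := ![b j, q₀] with hd
  set v : Fin 4 ⊕ Fin 2 → EuclideanSpace ℝ (Fin 6) :=
    Sum.elim (Fin.snoc (fun m : Fin 3 => padL (b (j.succAbove m))) axis) (fun a => padL (d a)) with hv
  have hvm : ∀ m : Fin 3, v (Sum.inl (Fin.castSucc m)) = padL (b (j.succAbove m)) := fun m => by
    rw [hv, Sum.elim_inl, Fin.snoc_castSucc]
  have hvl : v (Sum.inl (Fin.last 3)) = axis := by rw [hv, Sum.elim_inl, Fin.snoc_last]
  have hva : ∀ a : Fin 2, v (Sum.inr a) = padL (d a) := fun a => rfl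
  have hd0 : d 0 = b j := rfl
  have hd1 : d 1 = q₀ := rfl
  have hbb : ∀ i i', ⟪b i, b i'⟫ = if i = i' then (1 : ℝ) else 0 := orthonormal_iff_ite.1 hb
  have hqq : ⟪q₀, q₀⟫ = (1 : ℝ) := by rw [real_inner_self_eq_norm_sq, hq₀, one_pow]
  have hqb : ∀ k, ⟪q₀, b k⟫ = (0 : ℝ) := fun k => by rw [real_inner_comm, hbq k]
  -- the deleted pair is orthonormal and orthogonal to the kept horizontal vectors
  have hdd : ∀ a a' : Fin 2, ⟪d a, d a'⟫ = if a = a' then (1 : ℝ) else 0 := by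
    intro a a'
    fin_cases a <;> fin_cases a'
    · simp [hd0, hb.1 j]
    · simpa [hd0, hd1] using hbq j
    · simpa [hd0, hd1] using hqb j
    · simp [hd1, hq₀]
  have hdk : ∀ (a : Fin 2) (m : Fin 3), ⟪d a, b (j.succAbove m)⟫ = 0 := by
    intro a m
    fin_cases a
    · change ⟪b j, b (j.succAbove m)⟫ = 0
      rw [hbb, if_neg (Fin.succAbove_ne j m).symm]
    · exact hqb _
  -- orthonormality
  have hon : Orthonormal ℝ v := by
    rw [orthonormal_iff_ite]
    rintro (k | a) (k' | a')
    · -- kept/kept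
      induction k using Fin.lastCases with
      | last =>
        induction k' using Fin.lastCases with
        | last => rw [hvl, inner_axis_axis, if_pos rfl]
        | cast m' =>
          rw [hvl, hvm, real_inner_comm, inner_padL_axis, if_neg]
          exact fun h => (Fin.castSucc_lt_last m').ne' (Sum.inl_injective h)
      | cast m =>
        induction k' using Fin.lastCases with
        | last =>
          rw [hvl, hvm, inner_padL_axis, if_neg]
          exact fun h => (Fin.castSucc_lt_last m).ne (Sum.inl_injective h)
        | cast m' =>
          rw [hvm, hvm, inner_padL_padL, hbb]
          by_cases h : m = m'
          · subst h; rw [if_pos rfl, if_pos rfl]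
          · rw [if_neg (fun h' => h (Fin.succAbove_right_injective h')), if_neg]
            exact fun h' => h (Fin.castSucc_injective _ (Sum.inl_injective h'))
    · -- kept/deleted
      rw [if_neg Sum.inl_ne_inr, hva]
      induction k using Fin.lastCases with
      | last => rw [hvl, real_inner_comm, inner_padL_axis]
      | cast m => rw [hvm, inner_padL_padL, real_inner_comm, hdk]
    · -- deleted/kept
      rw [if_neg Sum.inr_ne_inl, hva]
      induction k' using Fin.lastCases with
      | last => rw [hvl, inner_padL_axis]
      | cast m' => rw [hvm, inner_padL_padL, hdk]
    · -- deleted/deleted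
      rw [hva, hva, inner_padL_padL, hdd]
      simp only [Sum.inr.injEq]
  have hsp : Submodule.span ℝ (Set.range v) = ⊤ :=
    hon.linearIndependent.span_eq_top_of_card_eq_finrank' (by simp)
  refine ⟨OrthonormalBasis.mk hon hsp.ge, fun m => ?_, ?_, ?_, ?_⟩
  · rw [OrthonormalBasis.coe_mk, hvm]
  · rw [OrthonormalBasis.coe_mk, hvl]
  · rw [OrthonormalBasis.coe_mk, hva, hd0]
  · rw [OrthonormalBasis.coe_mk, hva, hd1]

/-! ### The window certificate -/

variable {M : Type} [TopologicalSpace M] [ChartedSpace (EuclideanSpace ℝ (Fin 4)) M] [IsManifold (𝓡 4) ∞ M]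
  [CompactSpace M] [MeasurableSpace M] [BorelSpace M]

/-- **The window certificate.** See the module docstring: profile disagreement of measure `≥ d` on the window `(w₁, w₂)`
between every pair of columns of two measurable populations `A, F` of a chart box `Q = Icc lo hi` (inside the open unit disc of
the projection chart at the pole `q₀` with frame `b`) forces
`d · vol(A) · vol(F) ≤ 2 vol(Q) (Σⱼ (hiⱼ - loⱼ)) ∫⁻_{ι⁻¹(Q-columns × [w₁,w₂])} 2‖truncL (ν x)‖ d(ι^* μHE⁴)`.
[cite: Federer1969, 4.5.3 and 3.2.3] -/
theorem mul_volume_mul_volume_le_lintegral_tilt {ι ν : M → (EuclideanSpace ℝ (Fin 6))}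
    (hι : Manifold.IsSmoothEmbedding (𝓡 4) (𝓡 6) ∞ ι)
    (hιN : ∀ x, ∑ i : Fin 5, ι x (Fin.castSucc i) ^ 2 = 1)
    (hνc : Continuous ν) (hνn : (euclideanMetric (EuclideanSpace ℝ (Fin 6))).IsUnitNormal (𝓡 4) ι ν 1)
    (hνt : ∀ x, ∑ i : Fin 5, ν x (Fin.castSucc i) * ι x (Fin.castSucc i) = 0)
    {q₀ : EuclideanSpace ℝ (Fin 5)} {b : Fin 4 → EuclideanSpace ℝ (Fin 5)}
    (hb : Orthonormal ℝ b) (hq₀ : ‖q₀‖ = 1) (hbq : ∀ k, ⟪b k, q₀⟫ = 0)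
    {U : Set (EuclideanSpace ℝ (Fin 6))} (hUo : IsOpen U)
    (hfr : ∀ z ∈ closure U, z ∉ U → ∑ i : Fin 5, z (Fin.castSucc i) ^ 2 = 1 → z ∈ Set.range ι)
    {lo hi : Fin 4 → ℝ} (hQ : ∀ u ∈ Icc lo hi, ∑ k, u k ^ 2 < 1)
    {A F : Set (Fin 4 → ℝ)} (hAm : MeasurableSet A) (hFm : MeasurableSet F) (hA : A ⊆ Icc lo hi) (hF : F ⊆ Icc lo hi)
    {w₁ w₂ : ℝ} {d : ℝ≥0∞}
    (hdis : ∀ x ∈ A, ∀ y ∈ F, d ≤ volume {c : ℝ | c ∈ Ioo w₁ w₂ ∧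
      (padL (∑ k, x k • b k + Real.sqrt (1 - ∑ k, x k ^ 2) • q₀) + c • (axis : EuclideanSpace ℝ (Fin 6)) ∈ U ↔
        padL (∑ k, y k • b k + Real.sqrt (1 - ∑ k, y k ^ 2) • q₀) + c • (axis : EuclideanSpace ℝ (Fin 6)) ∉ U)}) :
    d * volume A * volume F ≤
      2 * volume (Icc lo hi) * (∑ j : Fin 4, ENNReal.ofReal (hi j - lo j)) *
        ∫⁻ x in ι ⁻¹' {z | (fun k : Fin 4 => ⟪b k, truncL z⟫) ∈ Icc lo hi ∧ z 5 ∈ Icc w₁ w₂},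
          ENNReal.ofReal (2 * ‖truncL (ν x)‖) ∂(Measure.comap ι (μHE[4] : Measure (EuclideanSpace ℝ (Fin 6)))) := by
  classical
  have hιc : Continuous ι := hι.contMDiff.continuous
  -- the projection chart and the lift to `ℝ⁶`
  set Φ : (Fin 4 → ℝ) → EuclideanSpace ℝ (Fin 5) := fun u => ∑ k, u k • b k + Real.sqrt (1 - ∑ k, u k ^ 2) • q₀
    with hΦ
  have hΦc : Continuous Φ := by
    refine Continuous.add (continuous_finsetSum _ fun k _ => (continuous_apply k).smul continuous_const) ?_
    exact (Real.continuous_sqrt.comp (continuous_const.sub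
      (continuous_finsetSum _ fun k _ => (continuous_apply k).pow 2))).smul continuous_const
  have hchart : ∀ u k, ⟪b k, Φ u⟫ = u k := fun u k => by
    rw [hΦ, inner_add_right, inner_smul_right, hbq k, mul_zero, add_zero, hb.inner_right_fintype]
  have hΦN : ∀ u : Fin 4 → ℝ, ∑ k, u k ^ 2 ≤ 1 → ∑ i : Fin 5, (Φ u) i ^ 2 = 1 := by
    intro u hu
    have hn : ‖Φ u‖ ^ 2 = 1 := by
      rw [← real_inner_self_eq_norm_sq, hΦ, inner_add_left, inner_add_right, inner_add_right, inner_smul_left,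
        inner_smul_right, inner_smul_left, inner_smul_right, hb.inner_sum, sum_inner, inner_sum]
      simp only [inner_smul_left, inner_smul_right, hbq, fun k => show ⟪q₀, b k⟫ = (0 : ℝ) by
        rw [real_inner_comm, hbq k], mul_zero, Finset.sum_const_zero, real_inner_self_eq_norm_sq, hq₀]
      simp only [conj_trivial, one_pow, mul_one, zero_add, add_zero]
      rw [← sq, Real.sq_sqrt (by linarith), ← Finset.sum_congr rfl fun k _ => (sq (u k))]
      ring
    rw [EuclideanSpace.norm_eq, Real.sq_sqrt (Finset.sum_nonneg fun i _ => sq_nonneg _)] at hn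
    simpa only [Real.norm_eq_abs, sq_abs] using hn
  -- the open set of chart space
  set U' : Set ((Fin 4 → ℝ) × ℝ) := {p | (∑ k, p.1 k ^ 2 < 1) ∧ p.2 ∈ Ioo w₁ w₂ ∧
    padL (Φ p.1) + p.2 • (axis : EuclideanSpace ℝ (Fin 6)) ∈ U} with hU'
  have hliftc : Continuous fun p : (Fin 4 → ℝ) × ℝ => padL (Φ p.1) + p.2 • (axis : EuclideanSpace ℝ (Fin 6)) :=
    (padL.continuous.comp (hΦc.comp continuous_fst)).add (continuous_snd.smul continuous_const)
  have hU'o : IsOpen U' := by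
    refine IsOpen.inter ?_ (IsOpen.inter ?_ (hUo.preimage hliftc))
    · exact isOpen_lt (continuous_finsetSum _ fun k _ => ((continuous_apply k).comp continuous_fst).pow 2)
        continuous_const
    · exact isOpen_Ioo.preimage continuous_snd
  -- telescoping over levels
  have hdis' : ∀ x ∈ A, ∀ y ∈ F, d ≤ volume {c : ℝ | ((x, c) ∈ U' ↔ (y, c) ∉ U')} := by
    intro x hx y hy
    refine (hdis x hx y hy).trans (measure_mono ?_)
    rintro c ⟨hc, hiff⟩
    have ex : (x, c) ∈ U' ↔ padL (Φ x) + c • (axis : EuclideanSpace ℝ (Fin 6)) ∈ U :=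
      ⟨fun h => h.2.2, fun h => ⟨hQ x (hA hx), hc, h⟩⟩
    have ey : (y, c) ∈ U' ↔ padL (Φ y) + c • (axis : EuclideanSpace ℝ (Fin 6)) ∈ U :=
      ⟨fun h => h.2.2, fun h => ⟨hQ y (hF hy), hc, h⟩⟩
    exact ⟨fun h h' => hiff.1 (ex.1 h) (ey.1 h'), fun h => ex.2 (hiff.2 fun h'' => h (ey.2 h''))⟩
  have htel := mul_volume_mul_volume_le_lintegral_levels (n := 3) hU'o lo hi hAm hFm hA hF hdis'
  refine htel.trans ?_
  -- the region `S ⊆ M` and the coordinate maps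
  set S : Set M := ι ⁻¹' {z | (fun k : Fin 4 => ⟪b k, truncL z⟫) ∈ Icc lo hi ∧ z 5 ∈ Icc w₁ w₂} with hS
  have hcoordc : Continuous fun z : EuclideanSpace ℝ (Fin 6) => fun k : Fin 4 => ⟪b k, truncL z⟫ :=
    continuous_pi fun k => continuous_const.inner truncL.continuous
  have hSc : IsClosed S := by
    refine IsClosed.preimage hιc (IsClosed.inter (isClosed_Icc.preimage hcoordc) ?_)
    exact isClosed_Icc.preimage (EuclideanSpace.proj (5 : Fin 6)).continuous
  set Ψ : Fin 4 → M → ℝ × (Fin 3 → ℝ) := fun j x =>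
    ((ι x) 5, fun m : Fin 3 => ⟪b (j.succAbove m), truncL (ι x)⟫) with hΨ
  have hΨc : ∀ j, Continuous (Ψ j) := fun j =>
    ((EuclideanSpace.proj (5 : Fin 6)).continuous.comp hιc).prodMk
      (continuous_pi fun m => continuous_const.inner (truncL.continuous.comp hιc))
  have hXm : ∀ j, MeasurableSet (Ψ j '' S) := fun j =>
    ((hSc.isCompact).image (hΨc j)).isClosed.measurableSet
  -- (a) frontier points of chart slices come from `Σ`
  have hincl : ∀ (j : Fin 4) (c : ℝ),
      Fin.removeNth j '' (frontier {x : Fin 4 → ℝ | (x, c) ∈ U'} ∩ Icc lo hi) ⊆ {v | (c, v) ∈ Ψ j '' S} := by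
    intro j c v hv
    obtain ⟨u, ⟨hufr, huQ⟩, rfl⟩ := hv
    have hu1 : ∑ k, u k ^ 2 < 1 := hQ u huQ
    have hso : IsOpen {x : Fin 4 → ℝ | (x, c) ∈ U'} := hU'o.preimage (Continuous.prodMk_left c)
    rw [hso.frontier_eq] at hufr
    obtain ⟨hucl, hunot⟩ := hufr
    have hc : c ∈ Ioo w₁ w₂ := by
      by_contra hc
      have he : {x : Fin 4 → ℝ | (x, c) ∈ U'} = ∅ := eq_empty_of_forall_notMem fun x hx => hc hx.2.1
      rw [he, closure_empty] at hucl
      exact hucl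
    have hzcl : padL (Φ u) + c • (axis : EuclideanSpace ℝ (Fin 6)) ∈ closure U := by
      have hcont : Continuous fun x : Fin 4 → ℝ => padL (Φ x) + c • (axis : EuclideanSpace ℝ (Fin 6)) :=
        (padL.continuous.comp hΦc).add continuous_const
      have hmaps : MapsTo (fun x : Fin 4 → ℝ => padL (Φ x) + c • (axis : EuclideanSpace ℝ (Fin 6)))
          {x : Fin 4 → ℝ | (x, c) ∈ U'} U := fun x hx => hx.2.2
      exact hmaps.closure hcont hucl
    have hznot : padL (Φ u) + c • (axis : EuclideanSpace ℝ (Fin 6)) ∉ U := fun h => hunot ⟨hu1, hc, h⟩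
    have hzN : ∑ i : Fin 5, (padL (Φ u) + c • (axis : EuclideanSpace ℝ (Fin 6))) (Fin.castSucc i) ^ 2 = 1 := by
      simp only [vert_apply_castSucc]
      exact hΦN u hu1.le
    obtain ⟨x₀, hx₀⟩ := hfr _ hzcl hznot hzN
    refine ⟨x₀, ?_, ?_⟩
    · change ι x₀ ∈ {z | (fun k : Fin 4 => ⟪b k, truncL z⟫) ∈ Icc lo hi ∧ z 5 ∈ Icc w₁ w₂}
      rw [hx₀, mem_setOf_eq, truncL_vert, vert_apply_five]
      refine ⟨?_, Ioo_subset_Icc_self hc⟩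
      have : (fun k : Fin 4 => ⟪b k, Φ u⟫) = u := funext fun k => hchart u k
      rw [this]
      exact huQ
    · rw [hΨ]
      change ((ι x₀) 5, fun m : Fin 3 => ⟪b (j.succAbove m), truncL (ι x₀)⟫) = (c, Fin.removeNth j u)
      rw [hx₀, vert_apply_five, truncL_vert]
      refine Prod.ext rfl (funext fun m => ?_)
      change ⟪b (j.succAbove m), Φ u⟫ = u (j.succAbove m)
      exact hchart u _
  -- (b) the coarea bound, direction by direction
  have hco : ∀ j : Fin 4, ∫⁻ c, volume {v : Fin 3 → ℝ | (c, v) ∈ Ψ j '' S} ≤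
      ∫⁻ x in S, ENNReal.ofReal (2 * ‖truncL (ν x)‖)
        ∂(Measure.comap ι (μHE[4] : Measure (EuclideanSpace ℝ (Fin 6)))) := by
    intro j
    obtain ⟨B, hB1, hB2, hB3, hB4⟩ := exists_orthonormalBasis_of_frame hb hq₀ hbq j
    have hB : ∀ a : Fin 2, B (Sum.inr a) 5 = 0 := by
      intro a
      fin_cases a
      · change B (Sum.inr 0) 5 = 0; rw [hB3, padL_apply_last]
      · change B (Sum.inr 1) 5 = 0; rw [hB4, padL_apply_last]
    have hΨB : Ψ j = fun x : M =>
        (⟪B (Sum.inl (Fin.last 3)), ι x⟫, fun m : Fin 3 => ⟪B (Sum.inl (Fin.castSucc m)), ι x⟫) := by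
      funext x
      rw [hΨ, hB2, inner_axis_left]
      refine Prod.ext rfl (funext fun m => ?_)
      change ⟪b (j.succAbove m), truncL (ι x)⟫ = ⟪B (Sum.inl (Fin.castSucc m)), ι x⟫
      rw [hB1, inner_padL_left]
    rw [hΨB]
    exact lintegral_volume_slice_image_coords_le hι hιN hνc hνn hνt B hB hSc
  -- (c) assemble
  have hg : ∀ j : Fin 4, Measurable fun c : ℝ => volume {v : Fin 3 → ℝ | (c, v) ∈ Ψ j '' S} := fun j =>
    measurable_measure_prodMk_left (hXm j)
  set V : ℝ≥0∞ := volume (Icc lo hi) with hV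
  set T : ℝ≥0∞ := ∫⁻ x in S, ENNReal.ofReal (2 * ‖truncL (ν x)‖)
    ∂(Measure.comap ι (μHE[4] : Measure (EuclideanSpace ℝ (Fin 6)))) with hT
  calc ∫⁻ c, 2 * (V * ∑ j : Fin 4, ENNReal.ofReal (hi j - lo j) *
          volume (Fin.removeNth j '' (frontier {x : Fin 4 → ℝ | (x, c) ∈ U'} ∩ Icc lo hi)))
      ≤ ∫⁻ c, 2 * (V * ∑ j : Fin 4, ENNReal.ofReal (hi j - lo j) * volume {v : Fin 3 → ℝ | (c, v) ∈ Ψ j '' S}) := by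
        refine lintegral_mono fun c => ?_
        gcongr with j _
        exact hincl j c
    _ = 2 * (V * ∑ j : Fin 4, ENNReal.ofReal (hi j - lo j) * ∫⁻ c, volume {v : Fin 3 → ℝ | (c, v) ∈ Ψ j '' S}) := by
        have hm1 : ∀ j : Fin 4, Measurable fun c : ℝ =>
            ENNReal.ofReal (hi j - lo j) * volume {v : Fin 3 → ℝ | (c, v) ∈ Ψ j '' S} := fun j =>
          (hg j).const_mul _
        have hm2 : Measurable fun c : ℝ =>
            ∑ j : Fin 4, ENNReal.ofReal (hi j - lo j) * volume {v : Fin 3 → ℝ | (c, v) ∈ Ψ j '' S} :=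
          Finset.measurable_sum _ fun j _ => hm1 j
        rw [lintegral_const_mul _ (hm2.const_mul _), lintegral_const_mul _ hm2,
          lintegral_finsetSum _ fun j _ => hm1 j]
        congr 2
        refine Finset.sum_congr rfl fun j _ => ?_
        rw [lintegral_const_mul _ (hg j)]
    _ ≤ 2 * (V * ∑ j : Fin 4, ENNReal.ofReal (hi j - lo j) * T) := by
        gcongr with j _
        exact hco j
    _ = 2 * V * (∑ j : Fin 4, ENNReal.ofReal (hi j - lo j)) * T := by
        rw [← Finset.sum_mul]
        ring

end Summit.SmoothPoincare4.SmoothPoincare4.Theorems.CylinderRungTwo.KillingFlux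

end
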